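import Summits.Schanuel.Schanuel.Theorems.DiophantineDichotomyApproximationPropertyBoxModIdeal
import Summits.Schanuel.Schanuel.Theorems.DiophantineDichotomyApproximationPropertySmallPrimeCurve
import Literature.NumberTheory.Transcendental.NesterenkoEliminationProp47Holds
import Literature.NumberTheory.Transcendental.PhilipponCriterionComponent
import Mathlib.RingTheory.Lasker
import HarnessLib

/-!
# Stub `small_prime_hypersurface` of line `orbit-interpolation-determinant` (crux `ApproximationProperty`, stmt-Schanuel-6117)

Route `DiophantineDichotomy` (sub-problem `Schanuel/Schanuel`), crux
`Summit.Schanuel.Schanuel.Theses.DiophantineDichotomy.ApproximationProperty` (stmt-Schanuel-6117),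
line `orbit-interpolation-determinant`, registered stub `small_prime_hypersurface`: **cut 1 of the
`t = 3` descent, in every ambient dimension `m ≥ 1` — a small irreducible hypersurface**. For
`ω ∈ ℂ^m` there is `c = c(m, ω) ≥ 1` such that for `Y ≥ Δ ≥ c` some prime `Q ∈ ℚ[x₀, …, x_m]`,
a form of degree `a`, `1 ≤ a ≤ Δ`, generates a prime principal ideal `(Q)` with `deg (Q) = a`,
`h((Q)) ≤ (2m² + 1) Y` and `log |(Q)(1, ω)| ≤ −(Δ^{m−1}/c) (Δ (h((Q)) + a) + Y a)`. This is the
`m`-dimensional port of the landed ternary stub `stub_smallPrimeCurve`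
(`…ApproximationPropertySmallPrimeCurve.lean`), now fed by the LANDED box principle for forms in
`m + 1` variables (`boxPrinciple`, `…ApproximationPropertyBoxModIdeal.lean`).

Proof (LNM 1752 Ch. 3 §4 throughout): with `D = ⌊Δ⌋`, `N = ⌊e^Y⌋`, `M = binom(D + m, D)` (all
monomials of degree `D`; `(D+1)^m ≤ m! M`, so `M ≥ 4` once `D ≥ 4 m!`) the form `P` of the box
principle (`1 ≤ |P| ≤ N`, `h(P) ≤ log N ≤ Y`, `|P(ω̄)| ≤ exp(c_B (D+1) − ((M−4)/2) Y)`) generates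
the homogeneous principal ideal `(P)`, unmixed of rank `m`
(`PhilipponMain.isUnmixedOfRank_span_singleton`), with `deg (P) = D`, `h((P)) ≤ Y + m² D`,
`|(P)(ω̄)| ≤ ‖P‖_ω̄ e^{2m² D}` (Prop. 4.8, `NesterenkoPhilippon2001_ch3_prop_4_8_holds`). The
weighted pigeonhole over Prop. 4.7
(`PhilipponMain.exists_component_le_exp`, weights `Δ` and `Y + Δ`) applied to a minimal primary
decomposition (Lasker–Noether) selects a primary component whose radical `𝔭` has
`log |𝔭(ω̄)| ≤ −((U − m³D)/T)(Δ h(𝔭) + (Y + Δ) deg 𝔭)`, `T ≤ 5 m² Δ Y`,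
`c (U − m³ D) ≥ 5 m² Δ^m Y` for `c = 2 · m! · (2 + 2 c_B + 7 m² + m³)`, whence the ratio is
`≥ Δ^{m−1}/c`. The associated prime `𝔭` of `(P)` is `(Q)` for a prime factor `Q ∣ P`
(`CycleAPIOne.exists_eq_span_prime_of_mem_associatedPrimes`), a form
(`Roy2013.isHomogeneous_of_dvd`) with `deg (Q) = deg Q ≥ 1` (Prop. 4.8 1),
`Literature.Barriers.Schanuel.one_le_ideg_of_isPrime`), `deg (Q) ≤ deg (P) = D ≤ Δ` and
`h((Q)) ≤ h((P)) + m² D ≤ Y + 2 m² D ≤ (2m² + 1) Y` (Prop. 4.7). The last monotonicity step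
reuses `SmallPrimeCurve.exp_weight_mono` of the landed ternary file.

Proofs only: no definitions, nothing asserted beyond the registered stub and private arithmetic.
Sources: Nesterenko, LNM 1752 (2001) Ch. 3 §4 Prop. 4.7, 4.8 (pp. 39–40); Philippon, Publ. Math.
IHÉS 64 (1986) §3 (the weighted choice of a prime component).
-/

set_option linter.dupNamespace false

noncomputable section

namespace Summit.Schanuel.Schanuel.Cruxes.ApproximationProperty.OrbitInterpolationDeterminant

open Literature.NumberTheory.Transcendental Literature.NumberTheory.Transcendental.Nesterenko
open MvPolynomial Module Real
open scoped BigOperators Nat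

namespace SmallPrimeHypersurface

/-! ## Arithmetic -/

/-- All monomials: `(D + 1)^m ≤ m! · binom(D + m, D)`. [folklore] -/
theorem succ_pow_le_factorial_mul_choose (D m : ℕ) : (D + 1) ^ m ≤ m ! * (D + m).choose D := by
  rw [Nat.choose_symm_add, ← Nat.ascFactorial_eq_factorial_mul_choose]
  exact Nat.pow_succ_le_ascFactorial (D + 1) m

/-- The weighted size of `(P)`: with `1 ≤ D ≤ Δ ≤ Y`, `0 ≤ h ≤ Y + μ² D`, `μ ≥ 1`,
`Δ (h + μ² D) + (Y + Δ) D ≤ 5 μ² Δ Y`. [folklore] -/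
theorem size_le {μ Δ Y D h : ℝ} (hμ : 1 ≤ μ) (hD1 : 1 ≤ D) (hDΔ : D ≤ Δ) (hΔY : Δ ≤ Y)
    (hhY : h ≤ Y + μ ^ 2 * D) :
    Δ * (h + μ ^ 2 * D) + (Y + Δ) * D ≤ 5 * μ ^ 2 * (Δ * Y) := by
  have hΔ0 : 0 ≤ Δ := by linarith
  have hY0 : 0 ≤ Y := by linarith
  have hμ2 : 1 ≤ μ ^ 2 := one_le_pow₀ hμ
  have e1 : Δ * h ≤ Δ * (Y + μ ^ 2 * D) := mul_le_mul_of_nonneg_left hhY hΔ0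
  have e2 : Δ * (μ ^ 2 * D) ≤ Δ * (μ ^ 2 * Y) :=
    mul_le_mul_of_nonneg_left (mul_le_mul_of_nonneg_left (hDΔ.trans hΔY) (by positivity)) hΔ0
  have e3 : (Y + Δ) * D ≤ (Y + Δ) * Δ := mul_le_mul_of_nonneg_left hDΔ (by linarith)
  have e4 : Δ * Δ ≤ Δ * Y := mul_le_mul_of_nonneg_left hΔY hΔ0
  have e5 : Δ * Y ≤ μ ^ 2 * (Δ * Y) := le_mul_of_one_le_left (by positivity) hμ2
  nlinarith [e1, e2, e3, e4, e5]

/-- The margin of the pigeonhole: with `c = 2 G A`, `A = 2 + 2 c_B + 7 μ² + μ³`, `G ≥ 1`,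
`c ≤ Δ ≤ Y`, `1 ≤ D ≤ Y`, `Δ ≤ E ≤ G M` (`E = Δ^m`, `G = m!`), one has
`5 μ² E Y ≤ c ((M − 4) Y/2 − c_B (D + 1) − 2 μ² D − μ³ D)`. [folklore] -/
theorem core_le {c cB μ G A Δ Y D M E : ℝ} (hcB : 0 < cB) (hμ : 1 ≤ μ) (hG : 1 ≤ G)
    (hA : A = 2 + 2 * cB + 7 * μ ^ 2 + μ ^ 3) (hc : c = 2 * G * A)
    (hcΔ : c ≤ Δ) (hΔY : Δ ≤ Y) (hDY : D ≤ Y) (hΔE : Δ ≤ E) (hEM : E ≤ G * M) :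
    5 * μ ^ 2 * (E * Y) ≤
      ((M - 4) / 2 * Y - cB * (D + 1) - 2 * μ ^ 2 * D - μ ^ 3 * D) * c := by
  have hμ2 : 1 ≤ μ ^ 2 := one_le_pow₀ hμ
  have hμ3 : 1 ≤ μ ^ 3 := one_le_pow₀ hμ
  have hA10 : 10 ≤ A := by rw [hA]; linarith
  have hA0 : 0 ≤ A := by linarith
  have hc20 : 20 ≤ c := by rw [hc]; nlinarith
  have hY1 : 1 ≤ Y := by linarith
  have hY0 : 0 ≤ Y := by linarith
  have hcE : c ≤ E := hcΔ.trans hΔE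
  -- the inner bracket, multiplied by `2G`
  have p1 : E * Y ≤ G * M * Y := mul_le_mul_of_nonneg_right hEM hY0
  have p2 : G * cB * (D + 1) ≤ G * cB * (2 * Y) :=
    mul_le_mul_of_nonneg_left (by linarith) (by positivity)
  have p3 : G * μ ^ 2 * D ≤ G * μ ^ 2 * Y := mul_le_mul_of_nonneg_left hDY (by positivity)
  have p4 : G * μ ^ 3 * D ≤ G * μ ^ 3 * Y := mul_le_mul_of_nonneg_left hDY (by positivity)
  have hinner : E * Y - 2 * G * (2 + 2 * cB + 2 * μ ^ 2 + μ ^ 3) * Y ≤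
      G * (M - 4) * Y - 2 * G * (cB * (D + 1)) - 4 * G * μ ^ 2 * D - 2 * G * μ ^ 3 * D := by
    nlinarith [p1, p2, p3, p4, mul_nonneg (by linarith : (0 : ℝ) ≤ G) hY0]
  have hAin := mul_le_mul_of_nonneg_left hinner hA0
  have p5 : c * ((2 + 2 * cB + 2 * μ ^ 2 + μ ^ 3) * Y) ≤
      E * ((2 + 2 * cB + 2 * μ ^ 2 + μ ^ 3) * Y) :=
    mul_le_mul_of_nonneg_right hcE (by positivity)
  calc 5 * μ ^ 2 * (E * Y)
      = A * (E * Y) - E * ((2 + 2 * cB + 2 * μ ^ 2 + μ ^ 3) * Y) := by rw [hA]; ring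
    _ ≤ A * (E * Y) - c * ((2 + 2 * cB + 2 * μ ^ 2 + μ ^ 3) * Y) := by linarith
    _ = A * (E * Y - 2 * G * (2 + 2 * cB + 2 * μ ^ 2 + μ ^ 3) * Y) := by rw [hc]; ring
    _ ≤ A * (G * (M - 4) * Y - 2 * G * (cB * (D + 1)) - 4 * G * μ ^ 2 * D -
          2 * G * μ ^ 3 * D) := hAin
    _ = ((M - 4) / 2 * Y - cB * (D + 1) - 2 * μ ^ 2 * D - μ ^ 3 * D) * c := by rw [hc]; ring

/-- The ratio of the pigeonhole: under the hypotheses of `core_le` and with `Pw Δ = E`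
(`Pw = Δ^{m−1}`), `0 ≤ h ≤ Y + μ² D`, `1 ≤ D ≤ Δ`,
`Pw/c ≤ ((M − 4) Y/2 − c_B (D+1) − 2μ²D − μ³D)/(Δ (h + μ² D) + (Y + Δ) D)`. [folklore] -/
theorem ratio_le {c cB μ G A Δ Y D M E Pw h : ℝ} (hcB : 0 < cB) (hμ : 1 ≤ μ) (hG : 1 ≤ G)
    (hA : A = 2 + 2 * cB + 7 * μ ^ 2 + μ ^ 3) (hc : c = 2 * G * A)
    (hcΔ : c ≤ Δ) (hΔY : Δ ≤ Y) (hD1 : 1 ≤ D) (hDΔ : D ≤ Δ) (hΔE : Δ ≤ E)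
    (hEM : E ≤ G * M) (hPw : Pw * Δ = E) (hPw0 : 0 ≤ Pw) (hh0 : 0 ≤ h)
    (hhY : h ≤ Y + μ ^ 2 * D) :
    Pw / c ≤ ((M - 4) / 2 * Y - cB * (D + 1) - 2 * μ ^ 2 * D - μ ^ 3 * D) /
      (Δ * (h + μ ^ 2 * D) + (Y + Δ) * D) := by
  have hμ2 : 1 ≤ μ ^ 2 := one_le_pow₀ hμ
  have hμ3 : 1 ≤ μ ^ 3 := one_le_pow₀ hμ
  have hA10 : 10 ≤ A := by rw [hA]; linarith
  have hc20 : 20 ≤ c := by rw [hc]; nlinarith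
  have hc0 : 0 < c := by linarith
  have hΔ0 : 0 < Δ := by linarith
  have hY0 : 0 < Y := by linarith
  have hD0 : 0 < D := by linarith
  have hT0 : 0 < Δ * (h + μ ^ 2 * D) + (Y + Δ) * D := by positivity
  rw [div_le_div_iff₀ hc0 hT0]
  calc Pw * (Δ * (h + μ ^ 2 * D) + (Y + Δ) * D) ≤ Pw * (5 * μ ^ 2 * (Δ * Y)) :=
        mul_le_mul_of_nonneg_left (size_le hμ hD1 hDΔ hΔY hhY) hPw0
    _ = 5 * μ ^ 2 * (E * Y) := by rw [← hPw]; ring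
    _ ≤ ((M - 4) / 2 * Y - cB * (D + 1) - 2 * μ ^ 2 * D - μ ^ 3 * D) * c :=
        core_le hcB hμ hG hA hc hcΔ hΔY (hDΔ.trans hΔY) hΔE hEM

/-- Non-negativity of the margin: under the hypotheses of `core_le`,
`μ³ D ≤ (M − 4) Y/2 − c_B (D + 1) − 2 μ² D`. [folklore] -/
theorem margin_nonneg {c cB μ G A Δ Y D M E : ℝ} (hcB : 0 < cB) (hμ : 1 ≤ μ) (hG : 1 ≤ G)
    (hA : A = 2 + 2 * cB + 7 * μ ^ 2 + μ ^ 3) (hc : c = 2 * G * A)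
    (hcΔ : c ≤ Δ) (hΔY : Δ ≤ Y) (hDY : D ≤ Y) (hΔE : Δ ≤ E) (hEM : E ≤ G * M) :
    μ ^ 3 * D ≤ (M - 4) / 2 * Y - cB * (D + 1) - 2 * μ ^ 2 * D := by
  have h := core_le hcB hμ hG hA hc hcΔ hΔY hDY hΔE hEM
  have hμ2 : 1 ≤ μ ^ 2 := one_le_pow₀ hμ
  have hμ3 : 1 ≤ μ ^ 3 := one_le_pow₀ hμ
  have hA10 : 10 ≤ A := by rw [hA]; linarith
  have hc20 : 20 ≤ c := by rw [hc]; nlinarith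
  have hY0 : 0 ≤ Y := by linarith
  have hE0 : 0 ≤ E := by linarith
  have h0 : 0 ≤ 5 * μ ^ 2 * (E * Y) := by positivity
  by_contra hneg
  push Not at hneg
  have : ((M - 4) / 2 * Y - cB * (D + 1) - 2 * μ ^ 2 * D - μ ^ 3 * D) * c < 0 :=
    mul_neg_of_neg_of_pos (by linarith) (by linarith)
  linarith

/-! ## The descent cut -/

/-- **Cut 1 in `ℙ^m` (curried form of the registered stub).** For `m ≥ 1` and `ω ∈ ℂ^m` there
is `c ≥ 1` (here `2 · m! · (2 + 2 c_B + 7 m² + m³)`, `c_B` the constant of `boxPrinciple`) such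
that for `Y ≥ Δ ≥ c` some prime factor `Q` of the pigeonhole form of degree `⌊Δ⌋` and height `≤ e^Y`
generates a prime ideal `(Q)`, `Q` a form of degree `a = deg (Q)`, `1 ≤ a ≤ Δ`,
`h((Q)) ≤ (2m² + 1) Y`, `|(Q)(1, ω)| ≤ exp(−(Δ^{m−1}/c)(Δ (h((Q)) + a) + Y a))`.
[cite: NesterenkoPhilippon2001, Ch. 3 Prop. 4.7, 4.8 (pp. 39–40)] -/
theorem main {m : ℕ} (hm : 1 ≤ m) (ω : Fin m → ℂ) :
    ∃ c : ℝ, 1 ≤ c ∧ ∀ Δ Y : ℝ, c ≤ Δ → Δ ≤ Y →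
      ∃ (Q : Rx m) (a : ℕ), Q ≠ 0 ∧ Q.IsHomogeneous a ∧ 1 ≤ a ∧ (a : ℝ) ≤ Δ ∧
        (Ideal.span {Q}).IsPrime ∧ ideg (Ideal.span {Q}) m = a ∧
        iheight (Ideal.span {Q}) m ≤ (2 * (m : ℝ) ^ 2 + 1) * Y ∧
        iabs (Ideal.span {Q}) m (Fin.cons 1 ω) ≤
          Real.exp (-(Δ ^ (m - 1) / c * (Δ * (iheight (Ideal.span {Q}) m + a) + Y * a))) := by
  classical
  letI := MvPolynomial.gradedAlgebra (σ := Fin (m + 1)) (R := ℚ)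
  obtain ⟨cB, hcB, hbox⟩ := boxPrinciple m ω
  have hm0 : m ≠ 0 := by omega
  -- the constants `μ = m`, `G = m!`, `A`, `c = 2 G A`
  set μ : ℝ := (m : ℝ) with hμdef
  have hμ : (1 : ℝ) ≤ μ := by rw [hμdef]; exact_mod_cast hm
  set G : ℝ := ((m ! : ℕ) : ℝ) with hGdef
  have hG : (1 : ℝ) ≤ G := by rw [hGdef]; exact_mod_cast Nat.succ_le_of_lt (Nat.factorial_pos m)
  obtain ⟨A, hA⟩ : ∃ A : ℝ, A = 2 + 2 * cB + 7 * μ ^ 2 + μ ^ 3 := ⟨_, rfl⟩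
  obtain ⟨c, hc⟩ : ∃ c : ℝ, c = 2 * G * A := ⟨_, rfl⟩
  have hμ2 : 1 ≤ μ ^ 2 := one_le_pow₀ hμ
  have hμ3 : 1 ≤ μ ^ 3 := one_le_pow₀ hμ
  have hA10 : 10 ≤ A := by rw [hA]; linarith
  have hcG : 4 * G + 1 ≤ c := by rw [hc]; nlinarith
  have hc1 : (1 : ℝ) ≤ c := by linarith
  refine ⟨c, hc1, fun Δ Y hΔ hY => ?_⟩
  have hΔ0 : 0 ≤ Δ := by linarith
  have hΔ1 : 1 ≤ Δ := by linarith
  have hY0 : 0 ≤ Y := by linarith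
  -- the degree `D = ⌊Δ⌋ ≥ 4 m!`
  set D : ℕ := ⌊Δ⌋₊ with hDdef
  have hDΔ : (D : ℝ) ≤ Δ := Nat.floor_le hΔ0
  have hΔD : Δ < D + 1 := Nat.lt_floor_add_one Δ
  have hDfac : 4 * m ! ≤ D := by
    have h1 : ((4 * m ! : ℕ) : ℝ) < D + 1 := by push_cast; linarith
    have h2 : 4 * m ! < D + 1 := by exact_mod_cast h1
    omega
  have hD1 : 1 ≤ D := le_trans (Nat.succ_le_of_lt (by positivity)) hDfac
  have hD1R : (1 : ℝ) ≤ D := by exact_mod_cast hD1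
  -- the number of monomials `M = binom(D + m, D)`, `(D + 1)^m ≤ m! M`, `M ≥ 4`
  set M : ℕ := (D + m).choose D with hMdef
  have hpowM : (D + 1) ^ m ≤ m ! * M := succ_pow_le_factorial_mul_choose D m
  have hM4 : 4 ≤ M := by
    have h1 : D + 1 ≤ (D + 1) ^ m := le_self_pow₀ (by omega) hm0
    have h2 : m ! * 4 ≤ m ! * M := by
      calc m ! * 4 = 4 * m ! := Nat.mul_comm _ _
        _ ≤ D + 1 := by omega
        _ ≤ m ! * M := h1.trans hpowM
    exact Nat.le_of_mul_le_mul_left h2 (Nat.factorial_pos m)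
  have hM4R : (4 : ℝ) ≤ (M : ℝ) := by exact_mod_cast hM4
  -- `E = Δ^m ≤ (D+1)^m ≤ G M`
  have hΔE : Δ ≤ Δ ^ m := le_self_pow₀ hΔ1 hm0
  have hEM : Δ ^ m ≤ G * M := by
    calc Δ ^ m ≤ ((D : ℝ) + 1) ^ m := pow_le_pow_left₀ hΔ0 hΔD.le m
      _ = (((D + 1) ^ m : ℕ) : ℝ) := by push_cast; ring
      _ ≤ ((m ! * M : ℕ) : ℝ) := by exact_mod_cast hpowM
      _ = G * M := by rw [hGdef]; push_cast; ring
  have hPw : Δ ^ (m - 1) * Δ = Δ ^ m := pow_sub_one_mul hm0 Δ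
  -- the box height `N = ⌊e^Y⌋ ≥ 1`
  set N : ℕ := ⌊Real.exp Y⌋₊ with hNdef
  have hN1 : 1 ≤ N := Nat.le_floor (by push_cast; linarith [Real.add_one_le_exp Y])
  have hN1R : (1 : ℝ) ≤ N := by exact_mod_cast hN1
  have hNexp : (N : ℝ) ≤ Real.exp Y := Nat.floor_le (Real.exp_pos Y).le
  have hlogN : Real.log N ≤ Y := by
    calc Real.log N ≤ Real.log (Real.exp Y) := Real.log_le_log (by linarith) hNexp
      _ = Y := Real.log_exp Y
  have hYlog : Y ≤ Real.log ((N : ℝ) + 1) := by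
    have h1 : Real.exp Y < N + 1 := Nat.lt_floor_add_one (Real.exp Y)
    calc Y = Real.log (Real.exp Y) := (Real.log_exp Y).symm
      _ ≤ Real.log ((N : ℝ) + 1) := Real.log_le_log (Real.exp_pos Y) h1.le
  -- Dirichlet's box principle for forms in `m + 1` variables
  obtain ⟨P, hP0, hPhom, hP1, -, hPht, hPval⟩ := hbox D N M hN1 hM4 le_rfl
  have hω₁ : (Fin.cons 1 ω : Fin (m + 1) → ℂ) ≠ 0 := PhilipponMain.cons_one_ne_zero ω
  have hω₁1 : 1 ≤ ‖(Fin.cons 1 ω : Fin (m + 1) → ℂ)‖ :=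
    PhilipponMain.one_le_norm_cons_one ω
  have hhtP : height P ≤ Y := hPht.trans hlogN
  -- `‖P(ω̄)‖ ≤ exp(c_B (D+1) − ((M−4)/2) Y)` and `‖P‖_ω̄ ≤ ‖P(ω̄)‖`
  have hPval' : ‖aeval (Fin.cons 1 ω : Fin (m + 1) → ℂ) P‖ ≤
      Real.exp (cB * (D + 1) - ((M : ℝ) - 4) / 2 * Y) := by
    refine hPval.trans (Real.exp_le_exp.mpr ?_)
    have h0 : 0 ≤ ((M : ℝ) - 4) / 2 := by linarith
    linarith [mul_le_mul_of_nonneg_left hYlog h0]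
  have hnorm : normAt (Fin.cons 1 ω) P ≤ Real.exp (cB * (D + 1) - ((M : ℝ) - 4) / 2 * Y) := by
    rw [normAt]
    refine (div_le_self (norm_nonneg _) ?_).trans hPval'
    exact one_le_mul_of_one_le_of_one_le hP1 (one_le_pow₀ hω₁1)
  -- the principal ideal `(P)`: homogeneous, unmixed of rank `m`; Proposition 4.8
  have hPu : ¬ IsUnit P := CycleAPIOne.not_isUnit_of_isHomogeneous hPhom hP0 hD1
  have hunm : IsUnmixedOfRank (Ideal.span {P}) m :=
    PhilipponMain.isUnmixedOfRank_span_singleton hP0 hPu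
  have hIhom : (Ideal.span {P}).IsHomogeneous (homogeneousSubmodule (Fin (m + 1)) ℚ) := by
    refine Ideal.homogeneous_span _ _ fun x hx => ?_
    rw [Set.mem_singleton_iff] at hx
    subst hx
    exact ⟨D, hPhom⟩
  obtain ⟨hdeg, hht, habs⟩ :=
    NesterenkoPhilippon2001_ch3_prop_4_8_holds m P D hm hP0 hPhom hunm _ hω₁
  have hh0 : 0 ≤ iheight (Ideal.span {P}) m := height_nonneg _
  have hhtI : iheight (Ideal.span {P}) m ≤ Y + μ ^ 2 * D := by rw [hμdef]; linarith
  -- the smallness exponent `U` and the weighted size `T` of `(P)`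
  obtain ⟨U, hUdef⟩ : ∃ U : ℝ,
      U = ((M : ℝ) - 4) / 2 * Y - cB * (D + 1) - 2 * μ ^ 2 * D := ⟨_, rfl⟩
  obtain ⟨Tw, hTwdef⟩ :
      ∃ Tw : ℝ, Tw = Δ * (iheight (Ideal.span {P}) m + μ ^ 2 * D) + (Y + Δ) * D :=
    ⟨_, rfl⟩
  have habsI : iabs (Ideal.span {P}) m (Fin.cons 1 ω) ≤ Real.exp (-U) := by
    refine habs.trans ?_
    calc normAt (Fin.cons 1 ω) P * Real.exp (2 * (m : ℝ) ^ 2 * D)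
        ≤ Real.exp (cB * (D + 1) - ((M : ℝ) - 4) / 2 * Y) * Real.exp (2 * (m : ℝ) ^ 2 * D) :=
          mul_le_mul_of_nonneg_right hnorm (Real.exp_pos _).le
      _ = Real.exp (-U) := by
          rw [← Real.exp_add, hUdef, hμdef]
          congr 1
          ring
  have hTw : 0 < Tw := by
    rw [hTwdef]
    have e1 : 0 ≤ Δ * (iheight (Ideal.span {P}) m + μ ^ 2 * D) := by positivity
    have e2 : 0 < (Y + Δ) * D := mul_pos (by linarith) (by linarith)
    linarith
  have hTle : Δ * (iheight (Ideal.span {P}) m + (m : ℝ) ^ 2 * (ideg (Ideal.span {P}) m : ℝ)) +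
      (Y + Δ) * (ideg (Ideal.span {P}) m : ℝ) ≤ Tw := by
    rw [hTwdef, hdeg, hμdef]
  have hUle : (m : ℝ) ^ 3 * (ideg (Ideal.span {P}) m : ℝ) ≤ U := by
    rw [hdeg, hUdef, ← hμdef]
    exact margin_nonneg hcB hμ hG hA hc hΔ hY (hDΔ.trans hY) hΔE hEM
  have hρ : Δ ^ (m - 1) / c ≤ (U - (m : ℝ) ^ 3 * (ideg (Ideal.span {P}) m : ℝ)) / Tw := by
    rw [hdeg, hUdef, hTwdef, ← hμdef]
    exact ratio_le hcB hμ hG hA hc hΔ hY hD1R hDΔ hΔE hEM hPw (by positivity) hh0 hhtI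
  -- a minimal primary decomposition of `(P)` and Proposition 4.7
  obtain ⟨T, hT⟩ := Submodule.IsLasker.exists_isMinimalPrimaryDecomposition
    (Submodule.isLasker (Rx m) (Rx m)) (Ideal.span {P})
  have h47 := NesterenkoPhilippon2001_ch3_prop_4_7_holds
  obtain ⟨hsum1, hsum2, -⟩ := h47 m m (Ideal.span {P}) hm le_rfl hIhom hunm T hT _ hω₁
  have hfacts := fun (Q : Ideal (Rx m)) (hQ : Q ∈ T) =>
    Literature.Barriers.Schanuel.radical_component_facts hIhom hunm hT hQ
  have hk : ∀ Q ∈ T, 1 ≤ primaryExponent Q := fun Q hQ => (hfacts Q hQ).2.2.2.2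
  -- the weighted pigeonhole: a small prime component `𝔭 = √Q'`
  obtain ⟨Q', hQ', hQ'le⟩ := PhilipponMain.exists_component_le_exp h47 (m := m) (r := m)
    hm le_rfl hIhom hunm hT hω₁ hΔ0 hTw hTle hUle habsI
  obtain ⟨h𝔭prime, h𝔭hom, h𝔭unm, -, -⟩ := hfacts Q' hQ'
  have h𝔭ass : Q'.radical ∈ (Ideal.span {P}).associatedPrimes := by
    have := hT.mem_associatedPrimes hQ'
    rwa [Submodule.colon_univ] at this
  have hdeg𝔭 := PhilipponMain.ideg_radical_le (r := m) hsum1 hk hQ'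
  have hht𝔭 := PhilipponMain.iheight_radical_le (r := m) hsum2 hk hQ'
  rw [hdeg] at hdeg𝔭 hht𝔭
  -- `𝔭 = (R)` for a prime factor `R` of `P`
  obtain ⟨R, hR, hRP, hRprime⟩ :=
    CycleAPIOne.exists_eq_span_prime_of_mem_associatedPrimes hP0 h𝔭ass
  rw [hR] at h𝔭prime h𝔭hom h𝔭unm hQ'le hdeg𝔭 hht𝔭
  have hR0 : R ≠ 0 := hRprime.ne_zero
  have hRhom : R.IsHomogeneous R.totalDegree := Roy2013.isHomogeneous_of_dvd hPhom hP0 hRP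
  obtain ⟨hdegR, -, -⟩ :=
    NesterenkoPhilippon2001_ch3_prop_4_8_holds m R R.totalDegree hm hR0 hRhom h𝔭unm _ hω₁
  have ha1 : 1 ≤ ideg (Ideal.span {R}) m :=
    Literature.Barriers.Schanuel.one_le_ideg_of_isPrime NesterenkoPhilippon2001_ch3_prop_4_4_holds
      hm le_rfl h𝔭prime h𝔭hom h𝔭unm
  have hhR0 : 0 ≤ iheight (Ideal.span {R}) m := height_nonneg _
  rw [hdegR] at ha1 hdeg𝔭 hQ'le
  have hDY : (D : ℝ) ≤ Y := hDΔ.trans hY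
  refine ⟨R, R.totalDegree, hR0, hRhom, ha1, ?_, h𝔭prime, hdegR, ?_, ?_⟩
  · -- `a ≤ D ≤ Δ`
    calc (R.totalDegree : ℝ) ≤ D := by exact_mod_cast hdeg𝔭
      _ ≤ Δ := hDΔ
  · -- `h((R)) ≤ h((P)) + m² D ≤ Y + 2 m² D ≤ (2m² + 1) Y`
    have e1 : (m : ℝ) ^ 2 * D ≤ (m : ℝ) ^ 2 * Y :=
      mul_le_mul_of_nonneg_left hDY (by positivity)
    rw [hμdef] at hhtI
    linarith
  · -- the accuracy
    refine hQ'le.trans (SmallPrimeCurve.exp_weight_mono hρ (by positivity) ?_)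
    ring

end SmallPrimeHypersurface

/-! ## The stub -/

/-- **Registered stub `small_prime_hypersurface` — cut 1 of the `t = 3` descent, any `m ≥ 1`: a
small irreducible hypersurface.** For `ω ∈ ℂ^m` there is `c = c(m, ω) ≥ 1` such that for
`Y ≥ Δ ≥ c` some prime `Q`, a form of degree `a`, `1 ≤ a ≤ Δ`, generates a prime principal ideal
`(Q)` of `ℚ[x₀, …, x_m]` with `deg (Q) = a`, `h((Q)) ≤ (2m² + 1) Y` and
`|(Q)(1, ω)| ≤ exp(−(Δ^{m−1}/c)(Δ (h((Q)) + a) + Y a))` — Dirichlet's box principle for forms in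
`m + 1` variables (`boxPrinciple`), LNM 1752 Ch. 3 Prop. 4.8 for `(P)`, the weighted pigeonhole over
Prop. 4.7 (Philippon 1986 §3), and the associated primes of a principal ideal of the factorial ring
`ℚ[x₀, …, x_m]`. [cite: NesterenkoPhilippon2001, Ch. 3 Prop. 4.7, 4.8 (pp. 39–40)] -/
theorem small_prime_hypersurface : ∀ (m : ℕ) (ω : Fin m → ℂ), 1 ≤ m → ∃ c : ℝ, 1 ≤ c ∧ ∀ Δ Y : ℝ, c ≤ Δ → Δ ≤ Y → ∃ (Q : Rx m) (a : ℕ), Q ≠ 0 ∧ Q.IsHomogeneous a ∧ 1 ≤ a ∧ (a : ℝ) ≤ Δ ∧ (Ideal.span {Q}).IsPrime ∧ ideg (Ideal.span {Q}) m = a ∧ iheight (Ideal.span {Q}) m ≤ (2 * (m : ℝ) ^ 2 + 1) * Y ∧ iabs (Ideal.span {Q}) m (Fin.cons 1 ω) ≤ Real.exp (-(Δ ^ (m - 1) / c * (Δ * (iheight (Ideal.span {Q}) m + a) + Y * a))) := by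
  intro m ω hm
  exact SmallPrimeHypersurface.main hm ω

end Summit.Schanuel.Schanuel.Cruxes.ApproximationProperty.OrbitInterpolationDeterminant

end
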